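import Summits.BirchSwinnertonDyer.Rank1Residual.X11b.TwistTransportRam
import Literature.NumberTheory.EllipticCurves.KramerCurvesPadic
import HarnessLib

/-!
# Class X11b, route p2: the minimal model of the twist by the Heegner field differs from `W^{(d_K)}` by a `p`-unit (cell `b2b-bsdres`, sub-cell `multr1-p2`)

HONEST FRAMING (cell `b2b-bsdres`, run/shared/lean/b2b/bsd-rank1-residual/, verbatim in every
file): the goal of the cell is to DELETE the COMBINATION-SHAPED residual classes of the
Birch–Swinnerton-Dyer formula for ALL analytic-rank `≤ 1` elliptic curves over `ℚ` — "full BSD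
formula for every rank `≤ 1` curve in class `C`" assembled STRICTLY from published theorems — so
that the rank-`≤ 1` remainder becomes exactly the CONSTRUCTION-SHAPED classes, which are TYPED
(missing-input `Prop`s), NOT attempted. This is not "finishing BSD". Sub-cell `multr1-p2` is a
RESEARCH ROUTE on class X11b; no claim beyond the stated class and locus.

THEOREMS ONLY (tree plumbing; item (e) of the transport list of HOME/b2b-bsdres-multr1-p2/REPORT.md
§5, the side condition `hu` of `bsdp_of_indexIdentityAt`). Let `W/ℚ` be globally minimal with
multiplicative reduction at `p`, `K` imaginary quadratic with every prime of the conductor split, and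
`Wd = Cd • W^{(d_K)}` a globally minimal model of the twist. Then `ord_p u(Cd) = 0`
(`padicValRat_u_eq_zero_of_twist_minimal`): `W ⊗ ℚ_p` and `Wd ⊗ ℚ_p` are `ℚ_p`-isomorphic
(`d_K` is a square in `ℚ_p`, `isSquare_discr_padic_of_heegner`) and both `ℤ_p`-minimal
(`isMinimal_map_padic_of_isGloballyMinimal`), so `v_p(Δ(Wd)) = v_p(Δ(W))` (Silverman *AEC* VII.1
Prop. 1.3(b), tree `valuation_Δ_eq_of_isMinimal_of_eq_smul`), while
`Δ(Wd) = u⁻¹² d_K⁶ Δ(W)` exactly (`variableChange_Δ`, `quadraticTwist_Δ`) with `p ∤ d_K`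
(`SatisfiesHeegnerHypothesis.not_dvd_discr`); hence `v_p(u)¹² = 1`. Auxiliary bridges between
Mathlib's `𝔪`-adic valuation on `ℚ_p` and `padicValRat` are proved here
(`valuation_maximalIdeal_intCast_eq_one`, `padicValRat_eq_zero_of_valuation_eq_one`).

References: [SilvermanAEC2009] VII.1 Prop. 1.3(b), X.5 Cor. 5.4; [Serre1973] II §3.3.
-/

noncomputable section

open scoped Classical

open WeierstrassCurve NumberField Literature.NumberTheory.EllipticCurves
  Literature.NumberTheory.EllipticCurves.Rank1Residual

namespace Summit.BirchSwinnertonDyer.Rank1Residual.X11b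

/-- An integer prime to `p` is a unit for the `𝔪_{ℤ_p}`-adic valuation of `ℚ_p`:
`v(n) = 1` (`n ∉ 𝔪 = pℤ_p`; Mathlib `valuation_eq_one_iff_notMem`,
`PadicInt.norm_int_lt_one_iff_dvd`). [folklore] -/
theorem valuation_maximalIdeal_intCast_eq_one (p : ℕ) [Fact p.Prime] {n : ℤ} (hn : ¬ (p : ℤ) ∣ n) :
    (IsDiscreteValuationRing.maximalIdeal ℤ_[p]).valuation ℚ_[p] (n : ℚ_[p]) = 1 := by
  have h : (n : ℚ_[p]) = algebraMap ℤ_[p] ℚ_[p] (n : ℤ_[p]) := by simp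
  rw [h, IsDedekindDomain.HeightOneSpectrum.valuation_eq_one_iff_notMem]
  change (n : ℤ_[p]) ∉ IsLocalRing.maximalIdeal ℤ_[p]
  rw [IsLocalRing.mem_maximalIdeal, PadicInt.mem_nonunits, PadicInt.norm_int_lt_one_iff_dvd]
  exact hn

/-- From the `𝔪_{ℤ_p}`-adic valuation to `padicValRat`: a non-zero rational `q` with `v(q) = 1` in
`ℚ_p` has `ord_p q = 0` (`v ≤ 1 ↔ ∈ ℤ_p ↔ ‖·‖ ≤ 1`, applied to `q` and `q⁻¹`, and
`‖q‖ = p^{-ord_p q}`). [folklore] -/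
theorem padicValRat_eq_zero_of_valuation_eq_one (p : ℕ) [Fact p.Prime] {q : ℚ} (hq : q ≠ 0)
    (h : (IsDiscreteValuationRing.maximalIdeal ℤ_[p]).valuation ℚ_[p] (q : ℚ_[p]) = 1) :
    padicValRat p q = 0 := by
  have hp : p.Prime := Fact.out
  have hq' : (q : ℚ_[p]) ≠ 0 := by exact_mod_cast hq
  have h1 : (q : ℚ_[p]) ∈ (algebraMap ℤ_[p] ℚ_[p]).range :=
    (WeierstrassCurve.valuation_maximalIdeal_le_one_iff_mem_range (R := ℤ_[p]) _).mp h.le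
  have h2 : (q : ℚ_[p])⁻¹ ∈ (algebraMap ℤ_[p] ℚ_[p]).range :=
    (WeierstrassCurve.valuation_maximalIdeal_le_one_iff_mem_range (R := ℤ_[p]) _).mp
      (by rw [map_inv₀, h, inv_one])
  obtain ⟨z1, hz1⟩ := h1
  obtain ⟨z2, hz2⟩ := h2
  have hn1 : ‖(q : ℚ_[p])‖ ≤ 1 := by rw [← hz1]; exact PadicInt.norm_le_one z1
  have hn2 : ‖(q : ℚ_[p])⁻¹‖ ≤ 1 := by rw [← hz2]; exact PadicInt.norm_le_one z2
  have hnorm : ‖(q : ℚ_[p])‖ = 1 := by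
    refine le_antisymm hn1 ?_
    rw [norm_inv] at hn2
    have hpos : 0 < ‖(q : ℚ_[p])‖ := norm_pos_iff.mpr hq'
    exact (inv_le_one₀ hpos).mp hn2
  have hval : (q : ℚ_[p]).valuation = 0 := by
    have hz := Padic.norm_eq_zpow_neg_valuation hq'
    rw [hnorm] at hz
    have hp1 : (1 : ℝ) < (p : ℝ) := by exact_mod_cast hp.one_lt
    have := zpow_right_injective₀ (zero_lt_one.trans hp1) hp1.ne' (hz.symm.trans (zpow_zero _).symm)
    omega
  rw [← Padic.valuation_ratCast, hval]

/-- **The side condition `ord_p u = 0` of the descent, at the multiplicative prime `p`, for the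
twist by the Heegner field.** Let `W/ℚ` be globally minimal and elliptic with multiplicative
reduction at `p`, `K` an imaginary quadratic field satisfying the Heegner hypothesis for the
conductor of `E` (every `ℓ ∣ N` split), and `Wd = Cd • W^{(d_K)}` a globally minimal model of the
twist. Then `ord_p u(Cd) = 0`. Proof: `p ∣ N`, so `d_K` is a square in `ℚ_p`
(`isSquare_discr_padic_of_heegner`) and `p ∤ d_K` (`SatisfiesHeegnerHypothesis.not_dvd_discr`);
`W ⊗ ℚ_p` and `Wd ⊗ ℚ_p` are `ℚ_p`-isomorphic `ℤ_p`-minimal equations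
(`isMinimal_map_padic_of_isGloballyMinimal`), so `v_p(Δ(Wd)) = v_p(Δ(W))`
(`valuation_Δ_eq_of_isMinimal_of_eq_smul`, Silverman VII.1 Prop. 1.3(b)); and
`Δ(Wd) = u⁻¹²·d_K⁶·Δ(W)` (`variableChange_Δ`, `quadraticTwist_Δ`), whence `v_p(u) = 1`.
This is item (e) of HOME/b2b-bsdres-multr1-p2/REPORT.md §5 (the binder `hu` of
`bsdp_of_indexIdentityAt`). [cite: SilvermanAEC2009, VII.1 Prop. 1.3(b) and X.5 Cor. 5.4] -/
theorem padicValRat_u_eq_zero_of_twist_minimal (W : WeierstrassCurve ℚ) [W.IsElliptic]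
    [W.IsGloballyMinimal] (p : ℕ) [Fact p.Prime] (K : Type) [Field K] [NumberField K]
    (hK : IsImaginaryQuadratic K) (hH : SatisfiesHeegnerHypothesis (W.conductorNorm ℤ) K)
    (hmult : W.HasMultiplicativeReductionAtPrime p) {Wd : WeierstrassCurve ℚ} [Wd.IsElliptic]
    [Wd.IsGloballyMinimal] (Cd : VariableChange ℚ)
    (hWd : Cd • W.quadraticTwist (NumberField.discr K : ℚ) = Wd) :
    padicValRat p (Cd.u : ℚ) = 0 := by
  have hp : p.Prime := Fact.out
  set d : ℚ := (NumberField.discr K : ℚ) with hd_def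
  have hD0 : d ≠ 0 := by rw [hd_def]; exact_mod_cast NumberField.discr_ne_zero K
  haveI : (W.baseChange ℚ_[p]).IsElliptic :=
    inferInstanceAs (W.map (algebraMap ℚ ℚ_[p])).IsElliptic
  haveI : (W.quadraticTwist d).IsElliptic := W.isElliptic_quadraticTwist hD0
  -- `p ∣ N`: `d_K` is a square in `ℚ_p` and `p ∤ d_K`
  have hpN : p ∣ W.conductorNorm ℤ :=
    (W.dvd_conductorNorm_iff_not_hasGoodReductionAtPrime p).mpr
      (WeierstrassCurve.HasMultiplicativeReduction.not_hasGoodReduction (R := ℤ_[p]) hmult)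
  have hsq : IsSquare (algebraMap ℚ ℚ_[p] d) := isSquare_discr_padic_of_heegner K hK hH p hpN
  have hpd : ¬ (p : ℤ) ∣ NumberField.discr K :=
    Literature.SatisfiesHeegnerHypothesis.not_dvd_discr hK.1 hH hp hpN
  -- the two minimal models over `ℚ_p` and the isomorphism between them
  obtain ⟨θ, hθ⟩ := hsq
  have hθ0 : θ ≠ 0 := by
    rintro rfl
    exact (map_ne_zero (algebraMap ℚ ℚ_[p])).mpr hD0 (hθ.trans (mul_zero 0))
  set X : WeierstrassCurve ℚ_[p] := W.baseChange ℚ_[p] with hX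
  set Y : WeierstrassCurve ℚ_[p] := Wd.baseChange ℚ_[p] with hY
  haveI hXmin : X.IsMinimal ℤ_[p] := isMinimal_map_padic_of_isGloballyMinimal W p
  haveI hYmin : Y.IsMinimal ℤ_[p] := isMinimal_map_padic_of_isGloballyMinimal Wd p
  obtain ⟨C, hC⟩ := (W.baseChange ℚ_[p]).exists_variableChange_smul_eq_quadraticTwist_sq hθ0
  have h1 : (W.quadraticTwist d).baseChange ℚ_[p] = C • X := by
    rw [hC, baseChange, baseChange, map_quadraticTwist, hθ, sq]
  have hYX : Y = (Cd.map (algebraMap ℚ ℚ_[p]) * C) • X := by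
    rw [hY, ← hWd, WeierstrassCurve.VariableChange.baseChange_smul_eq (W.quadraticTwist d) Cd ℚ_[p],
      h1, mul_smul]
  -- equal valuations of the minimal discriminants
  set V := (IsDiscreteValuationRing.maximalIdeal ℤ_[p]).valuation ℚ_[p] with hV
  have hval : V Y.Δ = V X.Δ := valuation_Δ_eq_of_isMinimal_of_eq_smul ℤ_[p] hYX
  -- `Δ(Wd) = u⁻¹² d⁶ Δ(W)` exactly
  have hΔd : Wd.Δ = (↑Cd.u⁻¹ : ℚ) ^ 12 * (d ^ 6 * W.Δ) := by
    rw [← hWd, variableChange_Δ, quadraticTwist_Δ]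
  have hYΔ : Y.Δ = algebraMap ℚ ℚ_[p] Wd.Δ := by rw [hY, baseChange, map_Δ]
  have hXΔ : X.Δ = algebraMap ℚ ℚ_[p] W.Δ := by rw [hX, baseChange, map_Δ]
  rw [hYΔ, hXΔ, hΔd] at hval
  simp only [map_mul, map_pow] at hval
  -- `v(Δ(W)) ≠ 0`, `v(d) = 1`
  have hΔ0 : V (algebraMap ℚ ℚ_[p] W.Δ) ≠ 0 :=
    (Valuation.ne_zero_iff V).mpr ((map_ne_zero _).mpr W.isUnit_Δ.ne_zero)
  have hvd : V (algebraMap ℚ ℚ_[p] d) = 1 := by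
    have : algebraMap ℚ ℚ_[p] d = ((NumberField.discr K : ℤ) : ℚ_[p]) := by
      rw [hd_def, map_intCast]
    rw [this]
    exact valuation_maximalIdeal_intCast_eq_one p hpd
  rw [hvd, one_pow, one_mul, mul_left_eq_self₀] at hval
  have hu12 : V (algebraMap ℚ ℚ_[p] (↑Cd.u⁻¹ : ℚ)) ^ 12 = 1 := hval.resolve_right hΔ0
  have hu1 : V (algebraMap ℚ ℚ_[p] (↑Cd.u⁻¹ : ℚ)) = 1 :=
    (pow_eq_one_iff_left (by norm_num)).mp hu12
  have hu : V ((Cd.u : ℚ) : ℚ_[p]) = 1 := by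
    rw [Units.val_inv_eq_inv_val, map_inv₀, map_inv₀, inv_eq_one] at hu1
    rw [← hu1, eq_ratCast]
  exact padicValRat_eq_zero_of_valuation_eq_one p (Cd.u.ne_zero) hu

end Summit.BirchSwinnertonDyer.Rank1Residual.X11b

end
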